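import Summits.QuantumFields.QCD.Theorems.RobustYangMills.Negative.BetaLipschitz

/-!
# `RobustYangMills` — negative lemma (gen 3): clause (iv) at `δ = η` bounds the renormalised lattice
Schwinger functions UNIFORMLY OVER THE WHOLE ADMISSIBLE CONE

Standing disprover (`cdisprove`, gen 3) for the shared crux
`Summit.QuantumFields.QCD.Theses.NestedDissectionSea.RobustYangMills` (item stmt-QuantumFields-13897,
rev 4); builds on `Negative/BetaLipschitz.lean` (gen 2).

* `ConeAdmAt κ η a L β' ℓ₀ W k` — the crux's admissibility predicate `AdmAt` at level `k` with the two
  constants `(κ, η)` explicit ((h1) lattice symmetries of the total, (h2) reflection positivity at `β'_k`,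
  (h3) `NormLE κ η`, (h4) range control, on every torus `S ≥ L_k`), `G = SU(3)` fundamental.
* `WilsonConeBounded κ η a L … β' ℓ₀` — ONE witness `(φ, c, m, T, Δ)` carrying the subsequential OS
  limit of the PURE `SU(3)` Wilson theory on `⁰𝒮` with non-trivial non-Gaussian curvature, `HasMassGap Δ`,
  the uniform lattice gap `HasLatticeMassGap … Δ`, AND: for every `(n, σ, f)` a `k`-uniform `C` such that,
  eventually in `k`, for EVERY family `W'` admissible at level `k`,
  `|𝔖_k(0) − 𝔖_k(W')| ≤ C · η` — the renormalised raw lattice moments of every admissible perturbation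
  (computed with WILSON's renormalisations `(c, m)`) stay within `C η` of the Wilson ones; in particular
  they are bounded in `k` uniformly over the cone (whenever the Wilson ones are).
* `robustYangMills_imp_coneBounded` — the crux implies `WilsonConeBounded κ (η₀ / max 1 (afBeta 0 Λ' ℓ₀))`
  for all data: feed `W ≡ 0` and compare in clause (iv) with an arbitrary admissible `W'` at
  `δ := η` (`‖0 − W'‖_{b,κ} ≤ η` by (h3) for `W'`).

Reading (Disproof.lean header item 5): at `δ ≥ η` clause (iv) is not a continuity statement but a
UNIFORM BOUNDEDNESS statement over the whole cone; harmless on `⁰𝒮`, it inherits the coincident-smearing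
defect of (iv) (header item 6) at `n ≥ 2`.
-/

noncomputable section

open MeasureTheory Filter Topology
open scoped ENNReal ComplexOrder
open Literature.MathematicalPhysics.QuantumLattice Literature.MathematicalPhysics.AQFT
  Literature.MathematicalPhysics.QuantumFieldTheory

namespace Summit.QuantumFields.QCD.Theorems.RobustYangMills.Negative

section Cone

/-- **The crux's admissibility predicate at level `k`**, constants `(κ, η)` explicit, `G = SU(3)`:
(h1) lattice symmetries of the total, (h2) reflection positivity at `β'_k`, (h3) `NormLE κ η`,
(h4) range control — on every torus `2S+1`, `S ≥ L_k` (verbatim the crux's local `AdmAt`). [folklore] -/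
def ConeAdmAt (κ η : ℝ) (a : ℕ → ℝ) (L : ℕ → ℕ) (β' : ℕ → ℝ) (ℓ₀ : ℝ)
    (W : (k : ℕ) → (S : ℕ) → QuasiLocalGaugePerturbation 4 (2 * S + 1) SU3 ⌊ℓ₀ / a k⌋₊) (k : ℕ) : Prop :=
  ∀ S : ℕ, L k ≤ S →
    (∀ (v : Site 4 (2 * S + 1)) (U : GaugeConfig 4 (2 * S + 1) SU3),
      (W k S).total (torusConfigShift v U) = (W k S).total U) ∧
    (∀ U : GaugeConfig 4 (2 * S + 1) SU3, (W k S).total (GaugeConfig.timeReflect U) = (W k S).total U) ∧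
    (∀ (π : Equiv.Perm (Fin 4)) (U : GaugeConfig 4 (2 * S + 1) SU3),
      (W k S).total (fun e => U (e.1 ∘ π, π.symm e.2)) = (W k S).total U) ∧
    (W k S).IsReflectionPositive ρ₃ (β' k) ∧
    (W k S).NormLE κ η ∧
    (∀ X : Finset (Site 4 (2 * S + 1)), X ∈ polymers ⌊ℓ₀ / a k⌋₊ →
      (∃ U : GaugeConfig 4 (2 * S + 1) SU3, (W k S).act X U ≠ 0) →
      ∀ y ∈ X, ∀ y' ∈ X, ∀ i : Fin 4,
        (y i - y' i).val ≤ ⌊ℓ₀ / a k⌋₊ * X.card ∨ (y' i - y i).val ≤ ⌊ℓ₀ / a k⌋₊ * X.card)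

/-- **`WilsonConsequences` plus the `δ = η` reading of clause (iv)**: ONE witness `(φ, c, m, T, Δ)` with
the subsequential OS limit of the pure `SU(3)` Wilson theory on `⁰𝒮`, non-trivial non-Gaussian curvature,
`HasMassGap Δ`, the uniform lattice gap `HasLatticeMassGap … Δ`, AND: for every `(n, σ, f)` a `k`-uniform
`C` such that eventually in `k`, for EVERY family `W'` admissible at level `k` (`ConeAdmAt κ η … W' k`),
`|𝔖_k(0) − 𝔖_k(W')| ≤ C η`, where `𝔖_k(W')` is the renormalised raw lattice moment of the `W'`-perturbed
theory at level `k`, computed with the witness's (Wilson) renormalisations `(c, m)`. [folklore] -/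
def WilsonConeBounded (κ η : ℝ) (a : ℕ → ℝ) (L : ℕ → ℕ) (ha : ∀ k, 0 < a k)
    (ha₀ : Filter.Tendsto a Filter.atTop (nhds 0))
    (haL : Filter.Tendsto (fun k => a k * L k) Filter.atTop Filter.atTop) (β' : ℕ → ℝ) (ℓ₀ : ℝ) : Prop :=
  let r₃ : LatticeRep SU3 := ⟨3, ρ₃, continuous_fundamentalRep _, fundamentalRep_injective _, fundamentalRep_mem_unitaryGroup⟩;
  ∃ φ : ℕ → ℕ, StrictMono φ ∧ ∃ (c m : YMSpecies SU3 → ℕ → ℝ) (T : OSData (YMSpecies SU3) 4) (Δ : ℝ),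
    0 < Δ ∧
    (∀ n : ℕ, n ≠ 0 → ∀ (σ : Fin n → YMSpecies SU3) (f : Fin n → SchwartzMap (EuclideanSpace ℝ (Fin 4)) ℝ)
      (F : SchwartzMap (Fin n → EuclideanSpace ℝ (Fin 4)) ℂ),
      IsTensorOf F (fun i => ofRealTest (f i)) → IsOffDiagonal F →
        Filter.Tendsto (fun j : ℕ => ((latticeSchwinger ρ₃
          (⟨a, ha, ha₀, β', L, haL, c, m⟩ : SpeciesScheme (YMSpecies SU3)) (fun s => s.F) (φ j) n σ f : ℝ) : ℂ))
          Filter.atTop (nhds (T.schwinger n σ F))) ∧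
    T.IsNontrivial r₃.curvature ∧ T.IsNonGaussian r₃.curvature ∧ T.HasMassGap Δ ∧
    HasLatticeMassGap r₃ (⟨a, ha, ha₀, β', L, haL, c, m⟩ : SpeciesScheme (YMSpecies SU3)) Δ ∧
    ∀ (n : ℕ) (σ : Fin n → YMSpecies SU3) (f : Fin n → SchwartzMap (EuclideanSpace ℝ (Fin 4)) ℝ),
      ∃ C : ℝ, ∀ᶠ k in Filter.atTop,
        ∀ W' : (k : ℕ) → (S : ℕ) → QuasiLocalGaugePerturbation 4 (2 * S + 1) SU3 ⌊ℓ₀ / a k⌋₊,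
          ConeAdmAt κ η a L β' ℓ₀ W' k →
          |latticeSchwinger ρ₃ (⟨a, ha, ha₀, β', L, haL, c, m⟩ : SpeciesScheme (YMSpecies SU3))
              (fun s => s.F) k n σ f -
            perturbedLatticeSchwinger ρ₃ (⟨a, ha, ha₀, β', L, haL, c, m⟩ : SpeciesScheme (YMSpecies SU3))
              (fun k => W' k (L k)) (fun s => s.F) k n σ f| ≤ C * η

/-- **The crux bounds the renormalised lattice moments uniformly over the admissible cone.** If
`RobustYangMills` holds with constants `(η₀, κ)`, then for all scaling data, every `N_f = 0` two-loop a.f.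
coupling sequence `β'` and every block scale `ℓ₀ > 0`, `WilsonConeBounded κ (η₀ / max 1 (afBeta 0 Λ' ℓ₀))`
holds: `W ≡ 0` is admissible (`isReflectionPositive_zero_odd`, `normLE_zero`, (h4) vacuous), and in clause
(iv) for `W ≡ 0` every admissible `W'` is at distance `δ := η` (`‖0 − W'_{k,S}‖_{b,κ} ≤ 0 + η` by (h3) for
`W'`, `NormLE.sub`). So the crux asserts MORE than continuity in `W`: with Wilson's renormalisations, the
moments of the whole cone are `Cη`-close to Wilson's, species by species, eventually in `k`. [folklore] -/
theorem robustYangMills_imp_coneBounded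
    (hR : Summit.QuantumFields.QCD.Theses.NestedDissectionSea.RobustYangMills) :
    ∃ η₀ : ℝ, 0 < η₀ ∧ ∃ κ : ℝ, 0 ≤ κ ∧
      ∀ (a : ℕ → ℝ) (L : ℕ → ℕ) (ha : ∀ k, 0 < a k) (ha₀ : Filter.Tendsto a Filter.atTop (nhds 0))
        (haL : Filter.Tendsto (fun k => a k * L k) Filter.atTop Filter.atTop) (β' : ℕ → ℝ) (Λ' : ℝ),
        0 < Λ' → Filter.Tendsto (fun k => β' k - afBeta 0 Λ' (a k)) Filter.atTop (nhds 0) →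
          ∀ ℓ₀ : ℝ, 0 < ℓ₀ → WilsonConeBounded κ (η₀ / max 1 (afBeta 0 Λ' ℓ₀)) a L ha ha₀ haL β' ℓ₀ := by
  obtain ⟨η₀, hη₀, κ, hκ, h⟩ := hR
  refine ⟨η₀, hη₀, κ, hκ, fun a L ha ha₀ haL β' Λ' hΛ' hβ' ℓ₀ hℓ₀ => ?_⟩
  have h1 := h a L ha ha₀ haL β' Λ' hΛ' hβ' ℓ₀ hℓ₀
  have hη : 0 ≤ η₀ / max 1 (afBeta 0 Λ' ℓ₀) :=
    div_nonneg hη₀.le (le_trans zero_le_one (le_max_left _ _))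
  have hpos : ∀ᶠ k in atTop, 0 ≤ β' k := eventually_nonneg_of_af ha ha₀ hΛ' hβ'
  have hL1 : ∀ᶠ k in atTop, 1 ≤ L k := by
    have h2 : ∀ᶠ k in atTop, (1 : ℝ) ≤ a k * L k := haL.eventually_ge_atTop 1
    have h3 : ∀ᶠ k in atTop, a k ≤ 1 := (ha₀.eventually (gt_mem_nhds one_pos)).mono fun k hk => hk.le
    filter_upwards [h2, h3] with k hk hk'
    by_contra hcon
    push Not at hcon
    have : L k = 0 := by omega
    rw [this] at hk
    simp at hk
    linarith
  obtain ⟨φ, hφ, c, m, T, Δ, hΔ, hconv, hnt, hng, hgapT, hgapL, hlip⟩ := h1 (fun k S => 0) (by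
    filter_upwards [hpos, hL1] with k hk hkL S hS
    refine ⟨fun v U => by simp, fun U => by simp, fun π U => by simp,
      isReflectionPositive_zero_odd ρ₃ (le_trans hkL hS) continuous_ρ₃ hk _,
      QuasiLocalGaugePerturbation.normLE_zero hη, ?_⟩
    rintro X - ⟨U, hU⟩
    simp at hU)
  refine ⟨φ, hφ, c, m, T, Δ, hΔ, fun n hn σ f F hF hF' => ?_, hnt, hng, hgapT, fun A B => ?_, fun n σ f => ?_⟩
  · have := hconv n hn σ f F hF hF'
    refine this.congr fun j => ?_
    exact congrArg (fun r : ℝ => (r : ℂ))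
      (perturbedLatticeSchwinger_zero ρ₃
        (⟨a, ha, ha₀, β', L, haL, c, m⟩ : SpeciesScheme (YMSpecies SU3))
        (bs := fun k => ⌊ℓ₀ / a k⌋₊) (fun s => s.F) (φ j) n σ f)
  · obtain ⟨C, hC⟩ := hgapL A B
    refine ⟨C, ?_⟩
    filter_upwards [hC] with k hk S hS n hn
    have := hk S hS n hn
    beta_reduce at this
    rwa [QuasiLocalGaugePerturbation.connectedCorr_zero] at this
  · obtain ⟨C, hC⟩ := hlip n σ f
    refine ⟨C, ?_⟩
    filter_upwards [hC] with k hk W' hW'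
    have e1 : perturbedLatticeSchwinger ρ₃ (⟨a, ha, ha₀, β', L, haL, c, m⟩ : SpeciesScheme (YMSpecies SU3))
        (fun k' => (0 : QuasiLocalGaugePerturbation 4 (2 * L k' + 1) SU3 ⌊ℓ₀ / a k'⌋₊)) (fun s => s.F) k n σ f =
        latticeSchwinger ρ₃ (⟨a, ha, ha₀, β', L, haL, c, m⟩ : SpeciesScheme (YMSpecies SU3)) (fun s => s.F) k n σ f :=
      perturbedLatticeSchwinger_zero ρ₃ _ _ k n σ f
    have key := hk W' (fun S hS => hW' S hS) (η₀ / max 1 (afBeta 0 Λ' ℓ₀)) hη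
      (fun S hS => by
        have := (QuasiLocalGaugePerturbation.normLE_zero le_rfl).sub (hW' S hS).2.2.2.2.1
        rwa [zero_add] at this)
    beta_reduce at key
    rw [e1] at key
    exact key

end Cone

end Summit.QuantumFields.QCD.Theorems.RobustYangMills.Negative

end
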